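import Mathlib.NumberTheory.Harmonic.Bounds
import Mathlib.Analysis.PSeries
import Literature.Probability.LatticeModels.TorusMomentumSumBound
import Literature.Probability.LatticeModels.TorusFourier
import HarnessLib

/-!
# The punctured momentum sum `Σ_{q ≠ 0} 1/E(q)` on the two-dimensional torus is `O(M² log² M)`

Topic `Probability/LatticeModels`, namespace `Literature.Probability.LatticeModels`. For the
nearest-neighbour dispersion `E(q) = dispersion (latticeMomentum M q) = Σ_{i<2} (1 − cos(2πq_i/M))`
on the discrete torus `(ℤ/M)²` (`TorusSite 2 M`), we prove the elementary lattice-sum estimate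

* **`sum_inv_dispersion_le_two_dim`** — `Σ_{q ≠ 0} 1/E(q) ≤ 2 M² (1 + log M)²`,

the finite-volume form of the logarithmic divergence `∫_{[-π,π]²} d²p/|p|²` of the massless lattice
Green function at the origin in `d = 2` (Friedli–Velenik 2017, §8.4, Thm. 8.22 / (8.39): the
variance of the massless GFF grows like `log n` in `d = 2`; Fernández–Fröhlich–Sokal 1992, §1.2). The
square of the logarithm (instead of the sharp single logarithm) is the price of the factorised
estimate `1/(a² + b²) ≤ 1/(2ab)` used below; it is immaterial for the applications (Chebyshev counts
of exceptional sites, where any `o(M/log M)` growth suffices).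

Ingredients (all in the tree or Mathlib): Jordan's inequality in the form
`8(|k|_M/M)² ≤ 1 − cos(2πk/M)` (`one_sub_cos_ge_valMinAbs`), the folding lemma
`sum_zmod_le_of_valMinAbs`, the harmonic bound `harmonic_le_one_add_log` and `Σ 1/i² ≤ 2`
(`sum_Ioo_inv_sq_le`).

## References

* S. Friedli, Y. Velenik, *Statistical Mechanics of Lattice Systems* (CUP 2017), §8.4.
  [FriedliVelenik2017]
* R. Fernández, J. Fröhlich, A. D. Sokal, *Random Walks, Critical Phenomena, and Triviality in
  Quantum Field Theory* (Springer 1992), §1.2. [FernandezFrohlichSokal1992]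
-/

noncomputable section

open Finset
open scoped Real

namespace Literature.Probability.LatticeModels

variable (M : ℕ) [NeZero M]

/-! ### One-dimensional folded sums: `Σ 1/|k|_M` and `Σ 1/|k|_M²` -/

/-- `Σ_{k ∈ ℤ/M, k ≠ 0} 1/|k|_M ≤ 2 (1 + log M)` (`|k|_M = |valMinAbs k|`; fold and use the harmonic
bound). [folklore] -/
theorem sum_inv_valMinAbs_le :
    ∑ k : ZMod M, (if k = 0 then (0 : ℝ) else 1 / (k.valMinAbs.natAbs : ℝ)) ≤
      2 * (1 + Real.log M) := by
  set g : ℕ → ℝ := fun j => if j = 0 then 0 else 1 / (j : ℝ) with hg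
  have hg0 : ∀ j, 0 ≤ g j := fun j => by
    simp only [hg]; split_ifs <;> positivity
  have hterm : ∀ k : ZMod M, (if k = 0 then (0 : ℝ) else 1 / (k.valMinAbs.natAbs : ℝ)) =
      g k.valMinAbs.natAbs := fun k => by
    simp only [hg]
    have : (k.valMinAbs.natAbs = 0) ↔ k = 0 := by
      rw [Int.natAbs_eq_zero, ZMod.valMinAbs_eq_zero]
    by_cases hk : k = 0
    · rw [if_pos hk, if_pos (this.2 hk)]
    · rw [if_neg hk, if_neg (fun h => hk (this.1 h))]
  simp_rw [hterm]
  refine (sum_zmod_le_of_valMinAbs M g hg0).trans ?_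
  have hg00 : g 0 = 0 := by simp [hg]
  rw [hg00, zero_add]
  have hsum : ∑ j ∈ Icc 1 (M / 2), g j = ∑ j ∈ Icc 1 (M / 2), ((j : ℝ))⁻¹ := by
    refine sum_congr rfl fun j hj => ?_
    have hj1 : j ≠ 0 := by have := (mem_Icc.1 hj).1; omega
    simp [hg, hj1]
  have hharm : ∑ j ∈ Icc 1 (M / 2), ((j : ℝ))⁻¹ = ((harmonic (M / 2) : ℚ) : ℝ) := by
    rw [harmonic_eq_sum_Icc, Rat.cast_sum]
    refine sum_congr rfl fun j _ => ?_
    push_cast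
    rfl
  rw [hsum, hharm]
  have h1 := harmonic_le_one_add_log (M / 2)
  have h2 : Real.log ((M / 2 : ℕ) : ℝ) ≤ Real.log M := by
    by_cases h0 : M / 2 = 0
    · rw [h0, Nat.cast_zero, Real.log_zero]
      exact Real.log_natCast_nonneg M
    · refine Real.log_le_log (by exact_mod_cast Nat.pos_of_ne_zero h0) ?_
      exact_mod_cast Nat.div_le_self M 2
  linarith

/-- `Σ_{k ∈ ℤ/M, k ≠ 0} 1/|k|_M² ≤ 4` (fold and use `Σ_{i ≥ 1} 1/i² ≤ 2`). [folklore] -/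
theorem sum_inv_valMinAbs_sq_le :
    ∑ k : ZMod M, (if k = 0 then (0 : ℝ) else 1 / (k.valMinAbs.natAbs : ℝ) ^ 2) ≤ 4 := by
  set g : ℕ → ℝ := fun j => if j = 0 then 0 else 1 / (j : ℝ) ^ 2 with hg
  have hg0 : ∀ j, 0 ≤ g j := fun j => by
    simp only [hg]; split_ifs <;> positivity
  have hterm : ∀ k : ZMod M, (if k = 0 then (0 : ℝ) else 1 / (k.valMinAbs.natAbs : ℝ) ^ 2) =
      g k.valMinAbs.natAbs := fun k => by
    simp only [hg]
    have : (k.valMinAbs.natAbs = 0) ↔ k = 0 := by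
      rw [Int.natAbs_eq_zero, ZMod.valMinAbs_eq_zero]
    by_cases hk : k = 0
    · rw [if_pos hk, if_pos (this.2 hk)]
    · rw [if_neg hk, if_neg (fun h => hk (this.1 h))]
  simp_rw [hterm]
  refine (sum_zmod_le_of_valMinAbs M g hg0).trans ?_
  have hg00 : g 0 = 0 := by simp [hg]
  rw [hg00, zero_add]
  have hsum : ∑ j ∈ Icc 1 (M / 2), g j = ∑ j ∈ Ioo 0 (M / 2 + 1), ((j : ℝ) ^ 2)⁻¹ := by
    have hI : Icc 1 (M / 2) = Ioo 0 (M / 2 + 1) := by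
      ext j; simp only [mem_Icc, mem_Ioo]; omega
    rw [hI]
    refine sum_congr rfl fun j hj => ?_
    have hj1 : j ≠ 0 := by have := (mem_Ioo.1 hj).1; omega
    simp [hg, hj1]
  rw [hsum]
  have h := sum_Ioo_inv_sq_le (α := ℝ) 0 (M / 2 + 1)
  norm_num at h
  linarith

/-! ### The dispersion dominates `8(|q₀|² + |q₁|²)/M²` -/

/-- **`E(q) ≥ 8(|q₀|_M² + |q₁|_M²)/M²`** on the two-dimensional torus (Jordan's inequality in each
coordinate). [folklore] -/
theorem dispersion_latticeMomentum_ge_two_dim (q : TorusSite 2 M) :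
    8 * (((q 0).valMinAbs.natAbs : ℝ) ^ 2 + ((q 1).valMinAbs.natAbs : ℝ) ^ 2) / (M : ℝ) ^ 2 ≤
      dispersion (latticeMomentum M q) := by
  have h0 := one_sub_cos_ge_valMinAbs M (q 0)
  have h1 := one_sub_cos_ge_valMinAbs M (q 1)
  simp only [dispersion, latticeMomentum, Fin.sum_univ_two]
  have e : ∀ k : ZMod M, 8 * ((k.valMinAbs.natAbs : ℝ) / M) ^ 2 =
      8 * (k.valMinAbs.natAbs : ℝ) ^ 2 / (M : ℝ) ^ 2 := fun k => by rw [div_pow]; ring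
  rw [e] at h0 h1
  have : 8 * (((q 0).valMinAbs.natAbs : ℝ) ^ 2 + ((q 1).valMinAbs.natAbs : ℝ) ^ 2) / (M : ℝ) ^ 2 =
      8 * ((q 0).valMinAbs.natAbs : ℝ) ^ 2 / (M : ℝ) ^ 2 +
        8 * ((q 1).valMinAbs.natAbs : ℝ) ^ 2 / (M : ℝ) ^ 2 := by ring
  rw [this]
  exact add_le_add h0 h1

/-- The elementary bound `1/(a² + b²) ≤ [a,b ≠ 0]/(2ab) + [a = 0]/b² + [b = 0]/a²` behind the
factorised estimate, for natural numbers not both zero. [folklore] -/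
theorem inv_sq_add_sq_le (a b : ℕ) (h : a ≠ 0 ∨ b ≠ 0) :
    1 / ((a : ℝ) ^ 2 + (b : ℝ) ^ 2) ≤
      (if a = 0 then (0 : ℝ) else 1 / (a : ℝ)) * (if b = 0 then (0 : ℝ) else 1 / (b : ℝ)) / 2 +
        (if a = 0 then (if b = 0 then (0 : ℝ) else 1 / (b : ℝ) ^ 2) else 0) +
        (if b = 0 then (if a = 0 then (0 : ℝ) else 1 / (a : ℝ) ^ 2) else 0) := by
  by_cases ha : a = 0
  · have hb : b ≠ 0 := h.resolve_left (not_not.2 ha)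
    subst ha
    simp only [Nat.cast_zero, if_true, if_neg hb]
    have : (0 : ℝ) ^ 2 + (b : ℝ) ^ 2 = (b : ℝ) ^ 2 := by ring
    rw [this]
    linarith
  by_cases hb : b = 0
  · subst hb
    simp only [Nat.cast_zero, if_true, if_neg ha]
    have : (a : ℝ) ^ 2 + (0 : ℝ) ^ 2 = (a : ℝ) ^ 2 := by ring
    rw [this]
    linarith
  simp only [if_neg ha, if_neg hb, add_zero]
  have ha' : (0 : ℝ) < a := by exact_mod_cast Nat.pos_of_ne_zero ha
  have hb' : (0 : ℝ) < b := by exact_mod_cast Nat.pos_of_ne_zero hb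
  rw [div_le_iff₀ (by positivity), show 1 / (a : ℝ) * (1 / (b : ℝ)) / 2 * ((a : ℝ) ^ 2 + (b : ℝ) ^ 2)
    = ((a : ℝ) ^ 2 + (b : ℝ) ^ 2) / (2 * (a * b)) by field_simp]
  rw [le_div_iff₀ (by positivity)]
  nlinarith [sq_nonneg ((a : ℝ) - b)]

/-- **The punctured sum of `1/E(q)` over the two-dimensional torus**:
`Σ_{q ≠ 0} 1/E(q) ≤ 2 M² (1 + log M)²` (`E(q) = Σᵢ (1 − cos qᵢ)`, `qᵢ = 2πkᵢ/M`). The finite-volume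
form of the logarithmic growth of the massless two-dimensional lattice Green function at the origin
(Friedli–Velenik 2017, §8.4). [cite: FriedliVelenik2017, §8.4] -/
theorem sum_inv_dispersion_le_two_dim :
    ∑ q ∈ (univ : Finset (TorusSite 2 M)).erase 0, 1 / dispersion (latticeMomentum M q) ≤
      2 * (M : ℝ) ^ 2 * (1 + Real.log M) ^ 2 := by
  classical
  have hM : (0 : ℝ) < M := by exact_mod_cast Nat.pos_of_ne_zero (NeZero.ne M)
  -- abbreviations for the one-dimensional weights
  set u : ZMod M → ℝ := fun k => if k = 0 then 0 else 1 / (k.valMinAbs.natAbs : ℝ) with hu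
  set v : ZMod M → ℝ := fun k => if k = 0 then 0 else 1 / (k.valMinAbs.natAbs : ℝ) ^ 2 with hv
  have hu0 : ∀ k, 0 ≤ u k := fun k => by simp only [hu]; split_ifs <;> positivity
  have hv0 : ∀ k, 0 ≤ v k := fun k => by simp only [hv]; split_ifs <;> positivity
  have hU := sum_inv_valMinAbs_le M
  have hV := sum_inv_valMinAbs_sq_le M
  rw [← hu] at hU
  rw [← hv] at hV
  -- the two-variable majorant
  set F : ZMod M → ZMod M → ℝ := fun a b =>
    u a * u b / 2 + (if a = 0 then v b else 0) + (if b = 0 then v a else 0) with hF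
  have hF0 : ∀ a b, 0 ≤ F a b := fun a b => by
    simp only [hF]
    have := mul_nonneg (hu0 a) (hu0 b); have := hv0 a; have := hv0 b
    split_ifs <;> positivity
  -- termwise bound for `q ≠ 0`
  have hz : ∀ k : ZMod M, (k.valMinAbs.natAbs = 0) ↔ k = 0 := fun k => by
    rw [Int.natAbs_eq_zero, ZMod.valMinAbs_eq_zero]
  have hterm : ∀ q : TorusSite 2 M, q ≠ 0 →
      1 / dispersion (latticeMomentum M q) ≤ (M : ℝ) ^ 2 / 8 * F (q 0) (q 1) := by
    intro q hq
    have hne : (q 0).valMinAbs.natAbs ≠ 0 ∨ (q 1).valMinAbs.natAbs ≠ 0 := by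
      by_contra hcon
      push Not at hcon
      apply hq
      funext i
      fin_cases i
      · exact (hz _).1 hcon.1
      · exact (hz _).1 hcon.2
    have hpos : 0 < ((q 0).valMinAbs.natAbs : ℝ) ^ 2 + ((q 1).valMinAbs.natAbs : ℝ) ^ 2 := by
      rcases hne with h | h
      · have : (0 : ℝ) < (q 0).valMinAbs.natAbs := by exact_mod_cast Nat.pos_of_ne_zero h
        positivity
      · have : (0 : ℝ) < (q 1).valMinAbs.natAbs := by exact_mod_cast Nat.pos_of_ne_zero h
        positivity
    have hE := dispersion_latticeMomentum_ge_two_dim M q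
    have h1 : 1 / dispersion (latticeMomentum M q) ≤
        (M : ℝ) ^ 2 / 8 * (1 / (((q 0).valMinAbs.natAbs : ℝ) ^ 2 + ((q 1).valMinAbs.natAbs : ℝ) ^ 2)) := by
      rw [show (M : ℝ) ^ 2 / 8 * (1 / (((q 0).valMinAbs.natAbs : ℝ) ^ 2 + ((q 1).valMinAbs.natAbs : ℝ) ^ 2))
        = 1 / (8 * (((q 0).valMinAbs.natAbs : ℝ) ^ 2 + ((q 1).valMinAbs.natAbs : ℝ) ^ 2) / (M : ℝ) ^ 2)
        by field_simp]
      exact one_div_le_one_div_of_le (by positivity) hE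
    have h2 := inv_sq_add_sq_le (q 0).valMinAbs.natAbs (q 1).valMinAbs.natAbs hne
    have hF' : (if (q 0).valMinAbs.natAbs = 0 then (0 : ℝ) else 1 / ((q 0).valMinAbs.natAbs : ℝ)) *
          (if (q 1).valMinAbs.natAbs = 0 then (0 : ℝ) else 1 / ((q 1).valMinAbs.natAbs : ℝ)) / 2 +
        (if (q 0).valMinAbs.natAbs = 0 then
          (if (q 1).valMinAbs.natAbs = 0 then (0 : ℝ) else 1 / ((q 1).valMinAbs.natAbs : ℝ) ^ 2) else 0) +
        (if (q 1).valMinAbs.natAbs = 0 then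
          (if (q 0).valMinAbs.natAbs = 0 then (0 : ℝ) else 1 / ((q 0).valMinAbs.natAbs : ℝ) ^ 2) else 0) =
        F (q 0) (q 1) := by
      simp only [hF, hu, hv, if_congr (hz (q 0)) rfl rfl, if_congr (hz (q 1)) rfl rfl]
    rw [hF'] at h2
    exact h1.trans (mul_le_mul_of_nonneg_left h2 (by positivity))
  -- the double sum of the majorant
  have hsumF : ∑ q : TorusSite 2 M, F (q 0) (q 1) =
      (∑ k : ZMod M, u k) * (∑ k : ZMod M, u k) / 2 + ∑ k : ZMod M, v k + ∑ k : ZMod M, v k := by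
    rw [← Equiv.sum_comp (finTwoArrowEquiv (ZMod M)).symm]
    simp only [finTwoArrowEquiv_symm_apply, Matrix.cons_val_zero, Matrix.cons_val_one]
    rw [Fintype.sum_prod_type]
    simp only [hF, sum_add_distrib]
    have e1 : ∑ a : ZMod M, ∑ b : ZMod M, u a * u b / 2 =
        (∑ k : ZMod M, u k) * (∑ k : ZMod M, u k) / 2 := by
      rw [sum_mul_sum, sum_div]
      refine sum_congr rfl fun a _ => ?_
      rw [sum_div]
    have e2 : ∑ a : ZMod M, ∑ b : ZMod M, (if a = 0 then v b else 0) = ∑ k : ZMod M, v k := by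
      rw [Fintype.sum_eq_single (0 : ZMod M) (fun a ha => by simp [ha])]
      simp
    have e3 : ∑ a : ZMod M, ∑ b : ZMod M, (if b = 0 then v a else 0) = ∑ k : ZMod M, v k := by
      refine sum_congr rfl fun a _ => ?_
      rw [Fintype.sum_eq_single (0 : ZMod M) (fun b hb => by simp [hb])]
      simp
    rw [e1, e2, e3]
  have hlog : 0 ≤ Real.log M := Real.log_natCast_nonneg M
  calc ∑ q ∈ (univ : Finset (TorusSite 2 M)).erase 0, 1 / dispersion (latticeMomentum M q)
      ≤ ∑ q ∈ (univ : Finset (TorusSite 2 M)).erase 0, (M : ℝ) ^ 2 / 8 * F (q 0) (q 1) :=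
        sum_le_sum fun q hq => hterm q (mem_erase.1 hq).1
    _ ≤ ∑ q : TorusSite 2 M, (M : ℝ) ^ 2 / 8 * F (q 0) (q 1) :=
        sum_le_sum_of_subset_of_nonneg (erase_subset _ _) fun q _ _ =>
          mul_nonneg (by positivity) (hF0 _ _)
    _ = (M : ℝ) ^ 2 / 8 * ((∑ k : ZMod M, u k) * (∑ k : ZMod M, u k) / 2 +
          ∑ k : ZMod M, v k + ∑ k : ZMod M, v k) := by rw [← mul_sum, hsumF]
    _ ≤ (M : ℝ) ^ 2 / 8 * ((2 * (1 + Real.log M)) * (2 * (1 + Real.log M)) / 2 + 4 + 4) := by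
        have hsu : 0 ≤ ∑ k : ZMod M, u k := sum_nonneg fun k _ => hu0 k
        have hlog' : 0 ≤ 1 + Real.log M := by linarith
        gcongr
    _ ≤ 2 * (M : ℝ) ^ 2 * (1 + Real.log M) ^ 2 := by
        have h1 : (1 : ℝ) ≤ (1 + Real.log M) ^ 2 := by nlinarith
        nlinarith [sq_nonneg (M : ℝ), mul_nonneg (sq_nonneg (M : ℝ)) (sub_nonneg.2 h1)]

end Literature.Probability.LatticeModels

end
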